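import Summits.Ventures.WeilGRH.FlatWindowCrossWindow
import HarnessLib

/-!
# GRH arm (rh-explicit, venture WeilGRH): THE FLAT-WINDOW DEFECTS FORM A POSITIVE-SEMIDEFINITE KERNEL IN THE
  WINDOW — the complete set of cross-window constraints

Cell `rh-explicit`, WEIL TRACK (structure seat weil-3, gen9).  Completion of `FlatWindowCrossWindow.lean`:
with `E(b) = ∫ 2sin²(bt)/t² dμ` (`= b·D(b)`, the normalized defect of the flat-window rung inequality at
window `b`, `FlatWindowMeanDefect.flatWindow_defect_eq`) and the identity
`2sin²((a+a′)t/2) − 2sin²((a−a′)t/2) = 2 sin(at) sin(a′t)`, the kernel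

  `K(a, a′) := E((a+a′)/2) − E(|a−a′|/2) = ∫ 2 sin(at) sin(a′t)/t² dμ(t)`

is the GRAM kernel of the functions `t ↦ sin(at)/t` in `L²(μ)`, hence POSITIVE SEMIDEFINITE:

* **`sum_sum_fejerKernel_nonneg`**: for every measure with `t⁻² ∈ L¹`, every finite family of windows
  `a_j` and reals `c_j`: `0 ≤ Σ_{j,k} c_j c_k [E((a_j+a_k)/2) − E((a_j−a_k)/2)]`
  (`= ∫ 2(Σ_j c_j sin(a_j t))²/t² dμ`);
* **`sum_sum_defectKernel_nonneg`** (rung language, every all-window representing measure of `Q_χ`):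
  the matrix `[m_{jk}·D(m_{jk}) − d_{jk}·D(d_{jk})]_{j,k}`, `m = (a_j+a_k)/2`, `d = |a_j−a_k|/2`, built from the
  smoothed prime sums at the midpoint and half-difference windows, is positive semidefinite.

This is Bochner's theorem in the WINDOW variable: `ξ ↦ M₂ − E(ξ/2) = ∫cos(ξt)t⁻²dμ` is positive definite;
the `2 × 2` case is the cross-window law of `FlatWindowCrossWindow.lean`.  No definitions, no named facts,
RH/GRH-free.
-/

set_option autoImplicit false

noncomputable section

open Complex Filter Set MeasureTheory
open scoped Real Topology ComplexConjugate ArithmeticFunction.vonMangoldt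

namespace Summit.Ventures.WeilGRH

open Literature.NumberTheory.LFunctions

variable {q : ℕ} {ι : Type*}

/-- The kernel entry: `E((a+a′)/2) − E((a−a′)/2) = ∫ 2 sin(at) sin(a′t)/t² dμ`. -/
theorem fejerEnergy_mid_sub_half (μ : Measure ℝ) (hM : Integrable (fun t : ℝ ↦ (t ^ 2)⁻¹) μ) (a a' : ℝ) :
    (∫ t, 2 * Real.sin ((a + a') / 2 * t) ^ 2 / t ^ 2 ∂μ) - ∫ t, 2 * Real.sin ((a - a') / 2 * t) ^ 2 / t ^ 2 ∂μ =
      ∫ t, 2 * (Real.sin (a * t) / t * (Real.sin (a' * t) / t)) ∂μ := by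
  rw [← integral_sub (integrable_fejerEnergy hM _) (integrable_fejerEnergy hM _)]
  refine integral_congr_ae (Eventually.of_forall fun t ↦ ?_)
  show 2 * Real.sin ((a + a') / 2 * t) ^ 2 / t ^ 2 - 2 * Real.sin ((a - a') / 2 * t) ^ 2 / t ^ 2 =
    2 * (Real.sin (a * t) / t * (Real.sin (a' * t) / t))
  have key : Real.sin ((a + a') / 2 * t) ^ 2 - Real.sin ((a - a') / 2 * t) ^ 2 =
      Real.sin (a * t) * Real.sin (a' * t) := by
    have e1 : a * t = (a + a') / 2 * t + (a - a') / 2 * t := by ring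
    have e2 : a' * t = (a + a') / 2 * t - (a - a') / 2 * t := by ring
    rw [e1, e2, Real.sin_add, Real.sin_sub]
    nlinarith [Real.sin_sq_add_cos_sq ((a + a') / 2 * t), Real.sin_sq_add_cos_sq ((a - a') / 2 * t)]
  have e3 : Real.sin (a * t) / t * (Real.sin (a' * t) / t) =
      (Real.sin ((a + a') / 2 * t) ^ 2 - Real.sin ((a - a') / 2 * t) ^ 2) / t ^ 2 := by
    rw [div_mul_div_comm, ← key, ← pow_two]
  rw [e3]
  ring

/-- **THE FLAT-WINDOW DEFECTS FORM A POSITIVE-SEMIDEFINITE KERNEL (measure level).**  For every measure `μ`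
with `t⁻² ∈ L¹(μ)`, every finite family of windows `a_j` and real coefficients `c_j`:

  `0 ≤ Σ_{j,k} c_j c_k [E((a_j+a_k)/2) − E((a_j−a_k)/2)] = ∫ 2(Σ_j c_j sin(a_j t))²/t² dμ`,

`E(b) = ∫ 2sin²(bt)/t² dμ` — the Gram kernel of `t ↦ sin(a_j t)/t` in `L²(μ)`. -/
theorem sum_sum_fejerKernel_nonneg {μ : Measure ℝ} (hM : Integrable (fun t : ℝ ↦ (t ^ 2)⁻¹) μ)
    (s : Finset ι) (a c : ι → ℝ) :
    0 ≤ ∑ j ∈ s, ∑ k ∈ s, c j * c k *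
      ((∫ t, 2 * Real.sin ((a j + a k) / 2 * t) ^ 2 / t ^ 2 ∂μ) -
        ∫ t, 2 * Real.sin ((a j - a k) / 2 * t) ^ 2 / t ^ 2 ∂μ) := by
  classical
  have hjk : ∀ j k, Integrable (fun t : ℝ ↦ c j * c k * (2 * (Real.sin (a j * t) / t * (Real.sin (a k * t) / t)))) μ :=
    fun j k ↦ ((integrable_sin_mul_sin_div_sq hM (a j) (a k)).const_mul 2).const_mul _
  -- rewrite every entry as an integral and pull the sums inside
  have hentry : ∀ j k, c j * c k * ((∫ t, 2 * Real.sin ((a j + a k) / 2 * t) ^ 2 / t ^ 2 ∂μ) -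
      ∫ t, 2 * Real.sin ((a j - a k) / 2 * t) ^ 2 / t ^ 2 ∂μ) =
      ∫ t, c j * c k * (2 * (Real.sin (a j * t) / t * (Real.sin (a k * t) / t))) ∂μ := fun j k ↦ by
    rw [fejerEnergy_mid_sub_half μ hM, ← integral_const_mul]
  simp_rw [hentry]
  set F : ι → ι → ℝ → ℝ := fun j k t ↦ c j * c k * (2 * (Real.sin (a j * t) / t * (Real.sin (a k * t) / t))) with hF
  have h1 : ∀ j, ∑ k ∈ s, ∫ t, F j k t ∂μ = ∫ t, ∑ k ∈ s, F j k t ∂μ := fun j ↦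
    (integral_finsetSum s (fun k _ ↦ hjk j k)).symm
  have h2 : ∑ j ∈ s, ∫ t, ∑ k ∈ s, F j k t ∂μ = ∫ t, ∑ j ∈ s, ∑ k ∈ s, F j k t ∂μ :=
    (integral_finsetSum s (fun j _ ↦ integrable_finsetSum s (fun k _ ↦ hjk j k))).symm
  show 0 ≤ ∑ j ∈ s, ∑ k ∈ s, ∫ t, F j k t ∂μ
  simp_rw [h1]
  rw [h2]
  refine integral_nonneg fun t ↦ ?_
  have hsq : ∑ j ∈ s, ∑ k ∈ s, F j k t = 2 * (∑ j ∈ s, c j * (Real.sin (a j * t) / t)) ^ 2 := by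
    rw [sq, Finset.sum_mul_sum, Finset.mul_sum]
    refine Finset.sum_congr rfl fun j _ ↦ ?_
    rw [Finset.mul_sum]
    refine Finset.sum_congr rfl fun k _ ↦ ?_
    simp only [hF]
    ring
  show 0 ≤ ∑ j ∈ s, ∑ k ∈ s, F j k t
  rw [hsq]; positivity

/-- **THE DEFECT KERNEL OF A RUNG FAMILY IS POSITIVE SEMIDEFINITE.**  Let `q ≠ 1` and `μ` represent `Q_χ`
on all tests with `t⁻² ∈ L¹(μ)`, and `E(b) = ∫ 2sin²(bt)/t² dμ`.  Then (i) `E(b) = b·D(b)` for every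
`b > 0`, `D(b) = log q − K_κ + I_κ(b)/b − 2S_χ(b) − 2b·μ{0}` the defect of the flat-window rung inequality
at window `b` (and `E(0) = 0`, `E` even), and (ii) for every finite family of windows `a_j` and reals `c_j`:

  `0 ≤ Σ_{j,k} c_j c_k [E((a_j+a_k)/2) − E((a_j−a_k)/2)]`

— the matrix of defects at the MIDPOINT and HALF-DIFFERENCE windows, `[m·D(m) − d·D(d)]`, is positive
semidefinite: the complete set of constraints tying the smoothed prime sums `S_χ` at different windows. -/
theorem sum_sum_defectKernel_nonneg (hq : q ≠ 1) (χ : DirichletCharacter ℂ q) {μ : Measure ℝ}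
    (hμ : ∀ g : ℝ → ℂ, IsWeilTest g →
      Integrable (fun t : ℝ ↦ ‖weilMellin g (1 / 2 + t * I)‖ ^ 2) μ ∧
        weilQuadraticChar χ g = ((∫ t, ‖weilMellin g (1 / 2 + t * I)‖ ^ 2 ∂μ : ℝ) : ℂ))
    (hM : Integrable (fun t : ℝ ↦ (t ^ 2)⁻¹) μ) (s : Finset ι) (a c : ι → ℝ) :
    let E : ℝ → ℝ := fun b ↦ ∫ t, 2 * Real.sin (b * t) ^ 2 / t ^ 2 ∂μ
    (∀ b : ℝ, 0 < b → E b = b * (Real.log q -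
          (Real.log (4 * π) + Real.eulerMascheroniConstant +
            2 * ∫ t in Ioi (0 : ℝ), weilKillingDensityPar (charParity χ) t) +
          1 / b * (∫ t in Ioi (0 : ℝ), weilArchDensityPar (charParity χ) t * min t (2 * b)) -
          2 * (∑ n ∈ weilPrimeIndex b,
            (Λ n : ℝ) / Real.sqrt n * ((1 - Real.log n / (2 * b)) * (χ (n : ZMod q)).re)) -
          2 * b * μ.real {0})) ∧
      0 ≤ ∑ j ∈ s, ∑ k ∈ s, c j * c k * (E ((a j + a k) / 2) - E ((a j - a k) / 2)) := by
  refine ⟨fun b hb ↦ ?_, sum_sum_fejerKernel_nonneg hM s a c⟩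
  obtain ⟨hF, heq⟩ := flatWindow_defect_eq hq χ hb (fun g hg _ ↦ hμ g hg)
  rw [heq, ← integral_const_mul]
  refine integral_congr_ae (Eventually.of_forall fun t ↦ ?_)
  show 2 * Real.sin (b * t) ^ 2 / t ^ 2 = b * (2 * Real.sin (b * t) ^ 2 / (b * t ^ 2))
  rcases eq_or_ne t 0 with rfl | ht
  · simp
  · field_simp

/-! ## Prime-free windows: sum rules -/

/-- Below the first prime the flat sum is empty: for `2b ≤ log 2` every `n` with `log n < 2b` has `n ≤ 1`,
so `Σ_{log n<2b} Λ(n)n^{-1/2}(1 − log n/(2b)) Re χ(n) = 0`. -/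
theorem flatSum_eq_zero_of_two_mul_le_log_two (χ : DirichletCharacter ℂ q) {b : ℝ} (hb : 2 * b ≤ Real.log 2) :
    ∑ n ∈ weilPrimeIndex b, (Λ n : ℝ) / Real.sqrt n * ((1 - Real.log n / (2 * b)) * (χ (n : ZMod q)).re) = 0 := by
  refine Finset.sum_eq_zero fun n hn ↦ ?_
  have hlog : Real.log n < 2 * b := mem_weilPrimeIndex.1 hn
  have hn2 : n < 2 := by
    by_contra h
    have h2 : (2 : ℝ) ≤ n := by exact_mod_cast not_lt.1 h
    have := Real.log_le_log two_pos h2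
    linarith
  interval_cases n <;> simp

/-- **SUM RULES AT PRIME-FREE WINDOWS.**  Let `q ≠ 1`, `μ` represent `Q_χ` on the tests of `[-b, b]`,
`0 < b`, `2b ≤ log 2`.  Then the Fejér energy at window `b` is EXPLICIT (no primes):
`∫ 2sin²(bt)/(bt²) dμ = log q − K_κ + I_κ(b)/b − 2b·μ{0}`, i.e.
`Σ_ρ 2sin²(bγ)/γ² = b(log q − K_κ) + I_κ(b) − 2b²·ord_{½}L` under `GRH(χ)` — the small-window energies
that serve as moduli of continuity in the cross-window law (`sq_sub_fejerEnergy_le_krein`) are prime-free. -/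
theorem defect_primeFree_eq (hq : q ≠ 1) (χ : DirichletCharacter ℂ q) {b : ℝ} (hb : 0 < b)
    (hb2 : 2 * b ≤ Real.log 2) {μ : Measure ℝ}
    (hμ : ∀ g : ℝ → ℂ, IsWeilTest g → tsupport g ⊆ Icc (-b) b →
      Integrable (fun t : ℝ ↦ ‖weilMellin g (1 / 2 + t * I)‖ ^ 2) μ ∧
        weilQuadraticChar χ g = ((∫ t, ‖weilMellin g (1 / 2 + t * I)‖ ^ 2 ∂μ : ℝ) : ℂ)) :
    ∫ t, 2 * Real.sin (b * t) ^ 2 / (b * t ^ 2) ∂μ =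
      Real.log q - (Real.log (4 * π) + Real.eulerMascheroniConstant +
            2 * ∫ t in Ioi (0 : ℝ), weilKillingDensityPar (charParity χ) t) +
        1 / b * (∫ t in Ioi (0 : ℝ), weilArchDensityPar (charParity χ) t * min t (2 * b)) -
        2 * b * μ.real {0} := by
  obtain ⟨-, heq⟩ := flatWindow_defect_eq hq χ hb hμ
  rw [flatSum_eq_zero_of_two_mul_le_log_two χ hb2] at heq
  linarith

end Summit.Ventures.WeilGRH

end
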